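import Summits.CriticalPhenomena.PercolationContinuityZ3.Theorems.PercNearOneGluingNoHeavyLinearLowerTail
import Summits.CriticalPhenomena.PercolationContinuityZ3.Theorems.PercNearOneGluingNoHeavyQuantLowerTailGluing
import HarnessLib

/-!
# QUANT lane R1: the typed family `Quant.QuantLowerTailGluingAt lam C` holds at `C = 1/(1 − lam)` for `0 ≤ lam < 1`; in particular `QuantLowerTailGluing 2`

Support file (`--supports stmt-CriticalPhenomena-4575`), seat `prim-quant-p1` (rung R1, lead's assignment 05:18Z); builds on p205010 (kernel theorem,
internal audit signed; external expert review pending).  No definitions, no named facts, no sorries; standard axioms.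

The statement family was typed by `prim-quant-stmt` (`…NoHeavyQuantLowerTailGluing.lean`, p207095) with the typer's note that `C = 1/(1 − lam)` follows from
`AdditiveGluing` + Markov; the `lam = 1/2`, `C = 2` case is this seat's `QuantGluing.linearLowerTail_two` (p207122, via the sharp event gluing).  Here:

* `linearLowerTail_frac` — for every `lam` (informative for `lam < 1`): `(1 − lam)·μ(1 ≤ N ∧ N < lam·|A|) ≤ s·μ(o ↔ A)` whenever `μ(a ↮ a') ≤ s` on `A × A` (first-moment counting of the
  missed relays, `> (1 − lam)|A|` of them on the event, plus `EventGluingSharp.eventGluing_sharp` for each missed relay);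
* `quantLowerTailGluingAt_of_lt_one` — `0 ≤ lam → lam < 1 → Quant.QuantLowerTailGluingAt lam (1 / (1 − lam))` (since `EN ≤ |A|` and `μ(o ↔ A) ≤ 1`);
* `quantLowerTailGluing_two` — `Quant.QuantLowerTailGluing 2` (the R1 target by name; `1/(1 − 1/2) = 2`).
What remains a census question (census-1): the SHARP constant of the strict form at `lam = 1/2`, known to lie in `(·, 2]`; the inclusive-threshold `C = 1` form is false
(`linearLowerTailInclusive_cex_five`). [cite: KozmaNitzan2024, Conj. 1 (p. 3), Conjecture 3 (p. 15)]
-/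

noncomputable section

namespace Summit.CriticalPhenomena.PercolationContinuityZ3.Theorems

open MeasureTheory Set
open Literature.Probability.LatticeModels (prodBernoulli)
open Literature.Probability.Percolation
open scoped Classical

namespace QuantGluing

variable {n : ℕ}

/-- **Linear lower tail at threshold fraction `lam`** (every finite weighted graph; informative for `lam < 1`): if `μ(a ↮ a') ≤ s` for all `a, a' ∈ A` then
`(1 − lam)·μ(1 ≤ N ∧ N < lam·|A|) ≤ s·μ(o ↔ A)`, `N = #{a ∈ A : o ↔ a}`.  On the event more than `(1 − lam)|A|` relays are missed while `o ↔ A`;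
first-moment counting and `μ({o ↔ A} ∩ {o ↮ a'}) ≤ s·μ(o ↔ A)` (`EventGluingSharp.eventGluing_sharp`) for each `a' ∈ A`.
[cite: KozmaNitzan2024, Conj. 1 (p. 3)] -/
theorem linearLowerTail_frac (n : ℕ) (w : Sym2 (Fin n) → unitInterval) (A : Finset (Fin n)) (o : Fin n) (s lam : ℝ)
    (hs : ∀ a ∈ A, ∀ a' ∈ A, (prodBernoulli w).real (openConn a a' : Set (BondConfig (Fin n)))ᶜ ≤ s) :
    (1 - lam) * (prodBernoulli w).real {ω : BondConfig (Fin n) | 1 ≤ (A.filter fun a => ω ∈ openConn o a).card ∧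
        ((A.filter fun a => ω ∈ openConn o a).card : ℝ) < lam * A.card} ≤
      s * (prodBernoulli w).real (⋃ a ∈ A, openConn o a) := by
  set μ := prodBernoulli w with hμ
  have hmeas : ∀ S : Set (BondConfig (Fin n)), MeasurableSet S := fun S => (Set.toFinite S).measurableSet
  set E : Set (BondConfig (Fin n)) := {ω | 1 ≤ (A.filter fun a => ω ∈ openConn o a).card ∧
      ((A.filter fun a => ω ∈ openConn o a).card : ℝ) < lam * A.card} with hE
  set U : Set (BondConfig (Fin n)) := ⋃ a ∈ A, openConn o a with hU
  -- `E ⊆ {o ↔ A}`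
  have hEU : E ⊆ U := by
    intro ω hω
    obtain ⟨h1, -⟩ := hω
    obtain ⟨a, ha⟩ := Finset.card_pos.1 h1
    rw [Finset.mem_filter] at ha
    exact Set.mem_biUnion (Finset.mem_coe.2 ha.1) ha.2
  -- counting: `(1 − lam)|A|·μ(E) ≤ Σ_{a'} μ(E ∩ {o ↮ a'})`
  have hcount : (1 - lam) * (A.card : ℝ) * μ.real E ≤
      ∑ a' ∈ A, μ.real (E ∩ (openConn o a' : Set (BondConfig (Fin n)))ᶜ) := by
    refine halfLeSevenForms_mul_measureReal_le_sum_inter μ A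
      (fun a' => (openConn o a' : Set (BondConfig (Fin n)))ᶜ) (fun a _ => hmeas _) (hmeas E) ((1 - lam) * (A.card : ℝ))
      fun ω hω => ?_
    rw [← halfLeSevenForms_card_filter_eq_sum_indicator]
    have hsplit := Finset.card_filter_add_card_filter_not (s := A) (fun a => ω ∈ openConn o a)
    obtain ⟨-, h2⟩ := hω
    have hcast : ((A.filter fun a => ω ∈ openConn o a).card : ℝ) +
        ((A.filter fun a => ¬ ω ∈ openConn o a).card : ℝ) = A.card := by
      exact_mod_cast hsplit
    have hrw : ((A.filter fun a => ω ∈ (openConn o a : Set (BondConfig (Fin n)))ᶜ).card : ℝ) =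
        ((A.filter fun a => ¬ ω ∈ openConn o a).card : ℝ) := rfl
    rw [hrw]
    nlinarith
  -- each missed relay
  have hterm : ∀ a' ∈ A, μ.real (E ∩ (openConn o a' : Set (BondConfig (Fin n)))ᶜ) ≤ s * μ.real U := by
    intro a' ha'
    have h := EventGluingSharp.eventGluing_sharp n w A o a' s fun a ha => hs a ha a' ha'
    rw [← hμ] at h
    exact (measureReal_mono (Set.inter_subset_inter_left _ hEU) (measure_ne_top _ _)).trans h
  rcases A.eq_empty_or_nonempty with hAe | hne
  · have hE0 : μ.real E = 0 := by
      have : E = ∅ := by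
        rw [Set.eq_empty_iff_forall_notMem]
        intro ω hω
        obtain ⟨h1, -⟩ := hω
        rw [hAe, Finset.filter_empty, Finset.card_empty] at h1
        exact absurd h1 (by norm_num)
      rw [this, measureReal_empty]
    have hU0 : μ.real U = 0 := by
      have : U = ∅ := by rw [hU, hAe]; simp
      rw [this, measureReal_empty]
    rw [hE0, hU0]; simp
  · have hpos : (0 : ℝ) < A.card := by exact_mod_cast Finset.card_pos.2 hne
    have hsum : ∑ a' ∈ A, μ.real (E ∩ (openConn o a' : Set (BondConfig (Fin n)))ᶜ) ≤ A.card * (s * μ.real U) := by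
      calc ∑ a' ∈ A, μ.real (E ∩ (openConn o a' : Set (BondConfig (Fin n)))ᶜ)
          ≤ ∑ a' ∈ A, s * μ.real U := Finset.sum_le_sum hterm
        _ = A.card * (s * μ.real U) := by simp
    have hkey : (A.card : ℝ) * ((1 - lam) * μ.real E) ≤ A.card * (s * μ.real U) := by nlinarith [hcount, hsum]
    exact le_of_mul_le_mul_left hkey hpos

/-- **`QuantLowerTailGluingAt lam (1/(1 − lam))` for `0 ≤ lam < 1`** (the typer's note, now a kernel theorem): `P(1 ≤ N < lam·EN) ≤ (1/(1−lam))·(P(o ↮ A) + s)`.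
From `linearLowerTail_frac` via `EN ≤ |A|` (so `lam·EN ≤ lam·|A|` for `lam ≥ 0`) and `μ(o ↔ A) ≤ 1`; the `P(o ↮ A)` term and `o ∉ A` are not needed.
[cite: KozmaNitzan2024, Conjecture 3 (p. 15)] -/
theorem quantLowerTailGluingAt_of_lt_one {lam : ℝ} (hlam0 : 0 ≤ lam) (hlam : lam < 1) :
    Quant.QuantLowerTailGluingAt lam (1 / (1 - lam)) := by
  intro n w A o s _ hs0 hs
  have hEN : (∑ a ∈ A, (prodBernoulli w).real (openConn o a : Set (BondConfig (Fin n)))) ≤ A.card := by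
    calc (∑ a ∈ A, (prodBernoulli w).real (openConn o a : Set (BondConfig (Fin n)))) ≤ ∑ a ∈ A, (1 : ℝ) :=
          Finset.sum_le_sum fun a _ => measureReal_le_one
      _ = A.card := by simp
  have hfrac := linearLowerTail_frac n w A o s lam hs
  have hsub : {ω : BondConfig (Fin n) | 1 ≤ (A.filter fun a => ω ∈ openConn o a).card ∧
        ((A.filter fun a => ω ∈ openConn o a).card : ℝ) < lam * ∑ a ∈ A, (prodBernoulli w).real (openConn o a)} ⊆
      {ω : BondConfig (Fin n) | 1 ≤ (A.filter fun a => ω ∈ openConn o a).card ∧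
        ((A.filter fun a => ω ∈ openConn o a).card : ℝ) < lam * A.card} := by
    intro ω hω
    obtain ⟨h1, h2⟩ := hω
    exact ⟨h1, lt_of_lt_of_le h2 (mul_le_mul_of_nonneg_left hEN hlam0)⟩
  have hmono := measureReal_mono (μ := prodBernoulli w) hsub (measure_ne_top _ _)
  have hU : (prodBernoulli w).real (⋃ a ∈ A, openConn o a : Set (BondConfig (Fin n))) ≤ 1 := measureReal_le_one
  have hUc : 0 ≤ (prodBernoulli w).real (⋃ a ∈ A, openConn o a : Set (BondConfig (Fin n)))ᶜ := measureReal_nonneg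
  have h1l : 0 < 1 - lam := by linarith
  -- `(1 − lam)·μ(E) ≤ s·μ(U) ≤ s ≤ μ(Uᶜ) + s`, then divide
  have hE : (1 - lam) * (prodBernoulli w).real {ω : BondConfig (Fin n) | 1 ≤ (A.filter fun a => ω ∈ openConn o a).card ∧
        ((A.filter fun a => ω ∈ openConn o a).card : ℝ) < lam * ∑ a ∈ A, (prodBernoulli w).real (openConn o a)} ≤
      (prodBernoulli w).real (⋃ a ∈ A, openConn o a : Set (BondConfig (Fin n)))ᶜ + s := by
    nlinarith [hfrac, hmono]
  rw [one_div, ← div_eq_inv_mul]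
  rw [le_div_iff₀ h1l]
  linarith

/-- **R1 by name: `QuantLowerTailGluing 2`** — Q-AG1 of QUANT.md §5 with `C = 2` on every finite weighted graph.
[cite: KozmaNitzan2024, Conjecture 3 (p. 15)] -/
theorem quantLowerTailGluing_two : Quant.QuantLowerTailGluing 2 := by
  have h := quantLowerTailGluingAt_of_lt_one (lam := 1 / 2) (by norm_num) (by norm_num)
  have h2 : (1 : ℝ) / (1 - 1 / 2) = 2 := by norm_num
  rw [h2] at h
  exact h

end QuantGluing

end Summit.CriticalPhenomena.PercolationContinuityZ3.Theorems

end
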